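import Literature.Analysis.FluidPDE.NSHopfGalerkin
import Literature.Analysis.FluidPDE.FractionalNSPrescribedEnergy
import HarnessLib

/-!
# Fractional Navier–Stokes on `𝕋³`: Leray's existence theorem via the Fourier–Galerkin scheme
  (proof architecture of `ColomboDeLellisDeRosa2018_thm11`, named sub-results, assembly)

Analysis/FluidPDE. This file decomposes the named fact
`Literature.Analysis.FluidPDE.ColomboDeLellisDeRosa2018_thm11`
(`Literature/Analysis/FluidPDE/FractionalNSPrescribedEnergy`: for `0 < α < 1` and every weakly
divergence-free `u₀ ∈ L²(𝕋³)` there is a Leray solution `Torus.IsLerayFracSolution α u₀ u` of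
`∂ₜv + div(v ⊗ v) + ∇p + (-Δ)^α v = 0`) along its printed proof — Colombo–De Lellis–De Rosa 2018,
§9 "Proof of Theorem 1.1" (p. 20 of the held arXiv text): Fourier truncation `P_K`, the
regularised system `∂ₜw + div P_K(w ⊗ w) + ∇q + (-Δ)^α w = 0`, `w(0) = P_K v̄`, "a system of
ordinary differential equations for the Fourier coefficients", the energy identity
`d/dt ∫|w|² = -2∫|(-Δ)^{α/2} w|²` giving global solvability and the uniform bound
`½∫|w_K|²(t) + ∫₀ᵗ∫|(-Δ)^{α/2}w_K|² = ½∫|P_K v̄|² ≤ ½∫|v̄|²`, then extraction of a limit and strong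
`L²_loc` convergence ("the proof follows a classical Aubin–Lions type argument"), "which would show
that `v` is a Leray solution" — into two named sub-results whose interface is an explicit
**fractional Galerkin scheme** predicate, exactly as the tree does for the classical (`α = 1`,
forced) Hopf existence theorem in `Literature/Analysis/FluidPDE/NSHopfGalerkin`
(`IsHopfGalerkinScheme`, `hopf_galerkin_scheme_exists`, `hopf_galerkin_limit`, both discharged in
`NSHopfGalerkinExistence` / `NSHopfGalerkinLimit`).

## Contents

* `IsFracGalerkinScheme α u₀ N U` — a sequence of Galerkin approximations of the fractional
  system (viscosity `1`, no force): orders `N n → ∞`, fields `U n` continuous on `[0, ∞) × T^d`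
  with slices in the Galerkin class `IsGalerkinMode (N n)` (real divergence-free vector
  trigonometric polynomials of degree `≤ N n`, from `NSHopfGalerkin`), the Galerkin equations
  tested against every Galerkin mode and integrated in time with the dissipative term
  `-⟪U, (-Δ)^α a⟫` (`Torus.fracLaplacian`, moved onto the test mode by symmetry), the exact energy
  identity with dissipation `Torus.eFracDissipation α` (the quantity of the energy inequalities of
  `Torus.IsLerayFracSolution`), and the datum `U n 0 = P_{N n} u₀ → u₀` (CDLDR §9, (NS_reg)).
* `fracGalerkin_scheme_exists` — **named fact** (CDLDR §9, first half: "(NS_reg) is globally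
  solvable" with the energy identity): every weakly divergence-free `L²` datum admits a
  fractional Galerkin scheme, for every `α ∈ ]0,1[`.
* `fracGalerkin_limit` — **named fact** (CDLDR §9, second half: uniform bounds, extraction,
  strong convergence, "`v` is a Leray solution"): every fractional Galerkin scheme has a
  subsequence converging to a Leray solution `Torus.IsLerayFracSolution α u₀ u`, for every
  `α ∈ ]0,1[`.
* `ColomboDeLellisDeRosa2018_thm11_of_fracGalerkin` — the **assembly** (real proof).

Both named facts are stated for the printed range of exponents `α ∈ ]0,1[` (CDLDR 2018, §1:
"where `α ∈ ]0,1[`"; the Galerkin argument itself is insensitive to the size of `α`, and the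
sequel modules prove the corresponding theorems for every `α > 0` and specialise). They are
discharged in the sequel modules `FracNSGalerkinExistence` (the Galerkin ODE, reusing the tree's
`Torus.galerkinField` with `ν = 0` and the spectral "force" `-(4π²|k|²)^α ĉ(k)`; the symmetry of
`(-Δ)^α` from `FracLaplacianSmooth`) and `FracNSGalerkinLimit` (compactness on the Fourier side as
in `NSHopfLimit`, energy inequalities in `[0, ∞]`, weak form), which adapt the tree's `α = 1`
development.

## Mathlib / tree search

Mathlib has no Navier–Stokes, Galerkin or fractional-Laplacian-on-the-torus material (see
`FractionalNSTorus`, `NSHopfGalerkin`). The tree has the classical scheme `IsHopfGalerkinScheme`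
(Laplacian dissipation, forced), which cannot be instantiated here: its clause `tendsto_force`
(`F n → f` in `L²ₜₓ`) fails for the spectral term `-(-Δ)^α U n`, so a parallel predicate is needed;
the Galerkin class `IsGalerkinMode` and all generic torus lemmas are reused.

## References

* M. Colombo, C. De Lellis, L. De Rosa, *Ill-posedness of Leray solutions for the hypodissipative
  Navier–Stokes equations*, Comm. Math. Phys. 362 (2018), 659–688 (held: arXiv:1708.05666), §1
  Thm. 1.1 and (2)–(3), §9 (proof of Thm. 1.1, p. 20). [`ColomboDelellisDerosa2018`]
* E. Hopf, *Über die Anfangswertaufgabe für die hydrodynamischen Grundgleichungen*, Math. Nachr.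
  4 (1951), §§2–4 (the method). [`Hopf1951`]
* J. C. Robinson, J. L. Rodrigo, W. Sadowski, *The three-dimensional Navier–Stokes equations*
  (CUP 2016), Thm. 4.4 (the `α = 1` template followed by the tree). [`RobinsonRodrigoSadowski2016`]
-/

noncomputable section

open MeasureTheory TopologicalSpace Set Function Filter Topology
open scoped InnerProductSpace RealInnerProductSpace ENNReal NNReal

namespace Literature.Analysis.FluidPDE

/-! ### The fractional Galerkin scheme (general dimension) -/

section Scheme

variable {d : Type*} [Fintype d] [DecidableEq d]

/-- **A fractional Galerkin scheme** for the system `∂ₜv + div(v ⊗ v) + ∇p + (-Δ)^α v = 0`,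
`div v = 0` on `T^d` with datum `u₀` (Colombo–De Lellis–De Rosa 2018, §9, the regularised problems
(NS_reg) `∂ₜw + div P_K(w ⊗ w) + ∇q + (-Δ)^α w = 0`, `w(·,0) = P_K v̄`, "a system of ordinary
differential equations for the Fourier coefficients"), recorded — as the tree's classical
`IsHopfGalerkinScheme` — through exactly the properties that the passage to the limit consumes:
* `U n` is jointly continuous on `[0, ∞) × T^d`, and every slice `U n t`, `t ≥ 0`, is a Galerkin
  mode of order `N n` (smooth, divergence free, band-limited to `|k| ≤ N n`) and weakly
  divergence free; `N n → ∞`;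
* the **Galerkin equations**, tested against every Galerkin mode `a` of order `N n` and integrated
  in time: `⟪U n t, a⟫ - ⟪U n s, a⟫ = ∫ₛᵗ (⟪U n, (U n·∇)a⟫ - ⟪U n, (-Δ)^α a⟫)` for `0 ≤ s ≤ t`
  (the projected equation paired with `a`, using `⟪(u·∇)u, a⟫ = -⟪u, (u·∇)a⟫` and the symmetry
  `⟪(-Δ)^α u, a⟫ = ⟪u, (-Δ)^α a⟫`);
* the **energy identity** `½‖U n t‖² + ∫ₛᵗ ∫|(-Δ)^{α/2} U n|² = ½‖U n s‖²`, `0 ≤ s ≤ t`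
  (CDLDR §9: "`d/dt ∫|w|² = -2∫|(-Δ)^{α/2}w|²`"), dissipation measured by the spectral
  `Torus.eFracDissipation α` as in `Torus.IsLerayFracSolution`;
* the datum: `⟪U n 0, a⟫ = ⟪u₀, a⟫` for every Galerkin mode `a` of order `N n`
  (`U n 0 = P_{N n} u₀`) and `‖U n 0 - u₀‖_{L²} → 0`.
[cite: ColomboDelellisDerosa2018, §9 (NS_reg) and the energy identity] -/
structure IsFracGalerkinScheme (α : ℝ) (u₀ : UnitAddTorus d → EuclideanSpace ℝ d) (N : ℕ → ℕ)
    (U : ℕ → ℝ → UnitAddTorus d → EuclideanSpace ℝ d) : Prop where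
  /-- The Galerkin orders exhaust all frequencies: `N n → ∞`. -/
  tendsto_order : Tendsto N atTop atTop
  /-- `U n` is jointly continuous on `[0, ∞) × T^d`. -/
  continuousOn : ∀ n, ContinuousOn (FunctionSpaces.Torus.stLift (U n)) (Ici 0 ×ˢ univ)
  /-- Every slice `U n t`, `t ≥ 0`, is a Galerkin mode of order `N n`. -/
  isGalerkinMode : ∀ n t, 0 ≤ t → IsGalerkinMode (N n) (U n t)
  /-- Every slice `U n t`, `t ≥ 0`, is weakly divergence free (`∫ ⟪U n t, ∇θ⟫ = 0`). -/
  isWeaklyDivFree : ∀ n t, 0 ≤ t → FunctionSpaces.Torus.IsWeaklyDivFree (U n t)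
  /-- The Galerkin equations tested against Galerkin modes and integrated in time, the
  dissipative term moved onto the mode (CDLDR 2018, §9 (NS_reg)). -/
  galerkin : ∀ n (a : UnitAddTorus d → EuclideanSpace ℝ d), IsGalerkinMode (N n) a →
    ∀ s t, 0 ≤ s → s ≤ t →
      (∫ x, ⟪U n t x, a x⟫) - ∫ x, ⟪U n s x, a x⟫ =
        ∫ τ in s..t, ∫ x, (⟪U n τ x, FunctionSpaces.Torus.convect (U n τ) a x⟫ -
          ⟪U n τ x, Torus.fracLaplacian α a x⟫)
  /-- The exact energy identity of the Galerkin approximations on every `[s, t] ⊆ [0, ∞)`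
  (CDLDR 2018, §9: `d/dt ∫|w|² = -2∫|(-Δ)^{α/2}w|²`). -/
  energy_eq : ∀ n s t, 0 ≤ s → s ≤ t →
    FunctionSpaces.Torus.kineticEnergy (U n t) + (∫⁻ τ in Ioo s t, Torus.eFracDissipation α (U n τ)).toReal =
      FunctionSpaces.Torus.kineticEnergy (U n s)
  /-- The datum of the `n`-th approximation is the Fourier truncation of `u₀`:
  `⟪U n 0, a⟫ = ⟪u₀, a⟫` for every Galerkin mode `a` of order `N n` (CDLDR 2018, §9:
  `w(·,0) = P_K(v̄)`). -/
  initial_inner : ∀ n (a : UnitAddTorus d → EuclideanSpace ℝ d), IsGalerkinMode (N n) a →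
    ∫ x, ⟪U n 0 x, a x⟫ = ∫ x, ⟪u₀ x, a x⟫
  /-- `U n 0 → u₀` in `L²(T^d)` (`‖P_K v̄ - v̄‖ → 0`). -/
  tendsto_initial : Tendsto (fun n => eLpNorm (U n 0 - u₀) 2 volume) atTop (𝓝 0)

/-- **A subsequence of a fractional Galerkin scheme is a fractional Galerkin scheme** (for the
same data): every clause is either pointwise in `n` or a limit along `n → ∞`. [folklore] -/
theorem IsFracGalerkinScheme.comp_strictMono {α : ℝ} {u₀ : UnitAddTorus d → EuclideanSpace ℝ d}
    {N : ℕ → ℕ} {U : ℕ → ℝ → UnitAddTorus d → EuclideanSpace ℝ d}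
    (hS : IsFracGalerkinScheme α u₀ N U) {φ : ℕ → ℕ} (hφ : StrictMono φ) :
    IsFracGalerkinScheme α u₀ (N ∘ φ) (U ∘ φ) where
  tendsto_order := hS.tendsto_order.comp hφ.tendsto_atTop
  continuousOn n := hS.continuousOn (φ n)
  isGalerkinMode n t ht := hS.isGalerkinMode (φ n) t ht
  isWeaklyDivFree n t ht := hS.isWeaklyDivFree (φ n) t ht
  galerkin n a ha s t hs hst := hS.galerkin (φ n) a ha s t hs hst
  energy_eq n s t hs hst := hS.energy_eq (φ n) s t hs hst
  initial_inner n a ha := hS.initial_inner (φ n) a ha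
  tendsto_initial := hS.tendsto_initial.comp hφ.tendsto_atTop

/-- The energy of a fractional Galerkin approximation is non-increasing: `E(U n t) ≤ E(U n s)` for
`0 ≤ s ≤ t` (the dissipation is nonnegative). [folklore] -/
theorem IsFracGalerkinScheme.kineticEnergy_le {α : ℝ} {u₀ : UnitAddTorus d → EuclideanSpace ℝ d}
    {N : ℕ → ℕ} {U : ℕ → ℝ → UnitAddTorus d → EuclideanSpace ℝ d}
    (hS : IsFracGalerkinScheme α u₀ N U) (n : ℕ) {s t : ℝ} (hs : 0 ≤ s) (hst : s ≤ t) :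
    FunctionSpaces.Torus.kineticEnergy (U n t) ≤ FunctionSpaces.Torus.kineticEnergy (U n s) := by
  have h := hS.energy_eq n s t hs hst
  have h0 : 0 ≤ (∫⁻ τ in Ioo s t, Torus.eFracDissipation α (U n τ)).toReal := ENNReal.toReal_nonneg
  linarith

end Scheme

/-! ### The two halves of the proof on `𝕋³`, and the assembly -/

/-- Local notation for physical space `ℝ³ = EuclideanSpace ℝ (Fin 3)`. -/
local notation "ℝ³" => EuclideanSpace ℝ (Fin 3)

/-- Local notation for the flat unit torus `𝕋³ = UnitAddTorus (Fin 3)`. -/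
local notation "𝕋³" => UnitAddTorus (Fin 3)

/-- **Existence of the fractional Galerkin approximations** (Colombo–De Lellis–De Rosa 2018, §9,
first half of the proof of Thm. 1.1, p. 20: the truncated problem (NS_reg) "reduces to a system
of ordinary differential equations for the Fourier coefficients of the solution, ensuring local
well-posedness", and "`d/dt ∫|w|² = -2∫|(-Δ)^{α/2}w|²` … by a standard continuation argument,
proves that the system of ODEs for `ŵ_k(t)` has a global solution on `ℝ⁺`"). For every
`α ∈ ]0,1[` (the paper's standing range, §1) and every weakly divergence-free `u₀ ∈ L²(𝕋³)` there
is a fractional Galerkin scheme `(N, U)` for `(α, u₀)` in the sense of `IsFracGalerkinScheme`.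
[cite: ColomboDelellisDerosa2018, §9 (proof of Thm. 1.1), (NS_reg)] -/
def fracGalerkin_scheme_exists : Prop :=
  ∀ (α : ℝ) (_hα : 0 < α) (_hα1 : α < 1) (u₀ : 𝕋³ → ℝ³) (_hu₀ : MemLp u₀ 2 volume)
    (_hdiv : FunctionSpaces.Torus.IsWeaklyDivFree u₀),
    ∃ (N : ℕ → ℕ) (U : ℕ → ℝ → 𝕋³ → ℝ³), IsFracGalerkinScheme α u₀ N U

/-- **Passage to the limit in the fractional Galerkin scheme** (Colombo–De Lellis–De Rosa 2018,
§9, second half of the proof of Thm. 1.1, p. 20: the uniform bound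
`½∫|w_K|²(t) + ∫₀ᵗ∫|(-Δ)^{α/2}w_K|² ≤ ½∫|v̄|²`, weak compactness in `L²(𝕋³ × [0,T])` for every `T`
with a diagonal argument, strong local convergence by "a classical Aubin–Lions type argument"
(mollification in `x`, Ascoli–Arzelà in `t`), "which would show that `v` is a Leray solution";
§1, remark after Thm. 1.1 for the energy inequality (3) from a.e. `s`). For every `α ∈ ]0,1[`
(the paper's standing range, §1) and every weakly divergence-free `u₀ ∈ L²(𝕋³)`, every fractional
Galerkin scheme `(N, U)` for `(α, u₀)` yields a Leray solution: there is `u : ℝ → 𝕋³ → ℝ³` with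
`Torus.IsLerayFracSolution α u₀ u`. [cite: ColomboDelellisDerosa2018, §9 (proof of Thm. 1.1) and §1 Thm. 1.1, (2)–(3)] -/
def fracGalerkin_limit : Prop :=
  ∀ (α : ℝ) (_hα : 0 < α) (_hα1 : α < 1) (u₀ : 𝕋³ → ℝ³) (_hu₀ : MemLp u₀ 2 volume)
    (_hdiv : FunctionSpaces.Torus.IsWeaklyDivFree u₀) (N : ℕ → ℕ) (U : ℕ → ℝ → 𝕋³ → ℝ³)
    (_hS : IsFracGalerkinScheme α u₀ N U),
    ∃ u : ℝ → 𝕋³ → ℝ³, Torus.IsLerayFracSolution α u₀ u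

/-- **Assembly of Leray's existence theorem for the fractional system on `𝕋³`**
(Colombo–De Lellis–De Rosa 2018, Thm. 1.1) from its two halves: the Galerkin approximations exist
(`fracGalerkin_scheme_exists`) and every Galerkin scheme has a Leray limit (`fracGalerkin_limit`).
Real proof (composition). [cite: ColomboDelellisDerosa2018, §9 (proof of Thm. 1.1)] -/
theorem ColomboDeLellisDeRosa2018_thm11_of_fracGalerkin (h₁ : fracGalerkin_scheme_exists)
    (h₂ : fracGalerkin_limit) : ColomboDeLellisDeRosa2018_thm11 := by
  intro α hα hα1 u₀ hu₀ hdiv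
  obtain ⟨N, U, hS⟩ := h₁ α hα hα1 u₀ hu₀ hdiv
  exact h₂ α hα hα1 u₀ hu₀ hdiv N U hS

end Literature.Analysis.FluidPDE
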